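import Summits.CriticalPhenomena.PercolationContinuityZ3.Theorems.SahiMasterFamilyKahnModuleOrOr

/-!
# Kahn's third-order inequality for JOINTLY MODULE-PEELABLE pairs
# (lineage `prim-master-conj`, gen 55; `--supports stmt-CriticalPhenomena-4575`)

Headline of the module-extension files (`…KahnModulePrelim`, `…KahnModule`, `…KahnModuleOrOr`).  Nothing here asserts Kahn's
Conjecture 5 [Kahn 2022] / Sahi's `C₃`; we prove it on an explicitly described infinite class.

`Peelable X w g h` (an inductive predicate over finite weighted preorders): the pair of indicators `(g,h) = (1_B,1_C)` on the
probability space `(X,w)` is *jointly module-peelable* — built from a nested pair `g ≤ h` on a Harris space by the moves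
(i) swap, (ii) attach an independent Harris module `(Y,w')` on which neither function depends, (iii)–(vii) attach a fresh Harris
module `Y` with a monotone indicator `v = 1_V` as `(B∧V, C)`, `(B∨V, C)`, `(B∧V, C∧V)`, `(B∨V, C∨V)` or `(B∧V, C∨V)`.
Since two-point spaces are Harris (`isHarris_bool`) this contains, on every product of Bernoulli spaces `{0,1}^n` with any
product measure, every pair of increasing events obtained from a trivial pair by repeatedly adding a block of FRESH coordinates
that enters each of `B`, `C` as a top conjunct, a top disjunct, or not at all — e.g. all pairs of read-once functions along a
common modular decomposition such as `(x₁x₂ ∨ x₃x₄, (x₁ ∨ x₂)x₅)`, pairs `(U ∧ V₁, U ∨ V₂)`, `(U ∧ V, U' ∨ V)` with `(U,U')`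
peelable, … ; neither function need be principal, and their supports may coincide.

**Theorem `Peelable.kahnPair`.**  Every jointly module-peelable pair is a Kahn pair: `E₃(f, g, h) ≥ 0` for EVERY monotone
`f ≥ 0` on `X` — Kahn's Conjecture 5 for `(A,B,C)` with `A` an arbitrary increasing event and `(B,C)` peelable (and, `E₃` being
symmetric, whenever any two of the three events form a peelable pair).  Proof: induction on the derivation, each step being one
of the module-extension theorems; Harris' inequality propagates by `isHarris_prodW`.  [this work]
-/

open Finset
open scoped BigOperators

namespace Summit.CriticalPhenomena.PercolationContinuityZ3.Theorems.SahiKahnModule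

universe u

/-- **Jointly module-peelable pairs** of indicators on finite weighted preorders (see the module docstring for the moves).
[this work] -/
inductive Peelable : (X : Type u) → [Fintype X] → [Preorder X] → (X → ℝ) → (X → ℝ) → (X → ℝ) → Prop where
  /-- base: a nested pair `g ≤ h` of monotone indicators on a Harris probability space. -/
  | of_le {X : Type u} [Fintype X] [Preorder X] {w g h : X → ℝ} :
      IsProbWeight w → IsHarris w → IsIndicator g → IsIndicator h → Monotone g → Monotone h → (∀ x, g x ≤ h x) →
      Peelable X w g h
  /-- swap the two functions. -/
  | symm {X : Type u} [Fintype X] [Preorder X] {w g h : X → ℝ} : Peelable X w g h → Peelable X w h g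
  /-- attach an independent Harris module on which neither function depends. -/
  | lift {X Y : Type u} [Fintype X] [Preorder X] [Fintype Y] [Preorder Y] {w g h : X → ℝ} {w' : Y → ℝ} :
      Peelable X w g h → IsProbWeight w' → IsHarris w' → Peelable (X × Y) (prodW w w') (liftX g) (liftX h)
  /-- `(B,C) ↦ (B ∧ V, C)` with `V` a monotone indicator on a fresh Harris module. -/
  | and_left {X Y : Type u} [Fintype X] [Preorder X] [Fintype Y] [Preorder Y] {w g h : X → ℝ} {w' v : Y → ℝ} :
      Peelable X w g h → IsProbWeight w' → IsHarris w' → IsIndicator v → Monotone v →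
      Peelable (X × Y) (prodW w w') (liftX g * liftY v) (liftX h)
  /-- `(B,C) ↦ (B ∨ V, C)`. -/
  | or_left {X Y : Type u} [Fintype X] [Preorder X] [Fintype Y] [Preorder Y] {w g h : X → ℝ} {w' v : Y → ℝ} :
      Peelable X w g h → IsProbWeight w' → IsHarris w' → IsIndicator v → Monotone v →
      Peelable (X × Y) (prodW w w') (bor g v) (liftX h)
  /-- `(B,C) ↦ (B ∧ V, C ∧ V)`. -/
  | and_and {X Y : Type u} [Fintype X] [Preorder X] [Fintype Y] [Preorder Y] {w g h : X → ℝ} {w' v : Y → ℝ} :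
      Peelable X w g h → IsProbWeight w' → IsHarris w' → IsIndicator v → Monotone v →
      Peelable (X × Y) (prodW w w') (liftX g * liftY v) (liftX h * liftY v)
  /-- `(B,C) ↦ (B ∨ V, C ∨ V)`. -/
  | or_or {X Y : Type u} [Fintype X] [Preorder X] [Fintype Y] [Preorder Y] {w g h : X → ℝ} {w' v : Y → ℝ} :
      Peelable X w g h → IsProbWeight w' → IsHarris w' → IsIndicator v → Monotone v →
      Peelable (X × Y) (prodW w w') (bor g v) (bor h v)
  /-- `(B,C) ↦ (B ∧ V, C ∨ V)`. -/
  | and_or {X Y : Type u} [Fintype X] [Preorder X] [Fintype Y] [Preorder Y] {w g h : X → ℝ} {w' v : Y → ℝ} :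
      Peelable X w g h → IsProbWeight w' → IsHarris w' → IsIndicator v → Monotone v →
      Peelable (X × Y) (prodW w w') (liftX g * liftY v) (bor h v)

/-- The invariant carried through a peeling derivation: probability weight, Harris, indicators, monotone, and KAHN PAIR.
[this work] -/
def Invariant {X : Type u} [Fintype X] [Preorder X] (w g h : X → ℝ) : Prop :=
  IsProbWeight w ∧ IsHarris w ∧ IsIndicator g ∧ IsIndicator h ∧ Monotone g ∧ Monotone h ∧ KahnPair w g h

/-- **Main theorem (invariant form).**  Every peeling derivation preserves the invariant; in particular the resulting pair is a
Kahn pair.  Induction on the derivation using `kahnPair_of_le`, `KahnPair.symm`, `kahnPair_liftX`, `kahnPair_and_left`,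
`kahnPair_or_left`, `kahnPair_and_and`, `kahnPair_or_or`, `kahnPair_and_or` and `isHarris_prodW`. [this work] -/
theorem Peelable.invariant {X : Type u} [Fintype X] [Preorder X] {w g h : X → ℝ} (hP : Peelable X w g h) :
    Invariant w g h := by
  induction hP with
  | of_le hw hX hg hh hgm hhm hle => exact ⟨hw, hX, hg, hh, hgm, hhm, kahnPair_of_le hw hX hg hh hgm hle⟩
  | symm _ ih =>
      obtain ⟨hw, hX, hg, hh, hgm, hhm, hK⟩ := ih
      exact ⟨hw, hX, hh, hg, hhm, hgm, hK.symm⟩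
  | lift _ hw' hY ih =>
      obtain ⟨hw, hX, hg, hh, hgm, hhm, hK⟩ := ih
      exact ⟨isProbWeight_prodW hw hw', isHarris_prodW hw hw' hX hY, isIndicator_liftX hg, isIndicator_liftX hh,
        monotone_liftX hgm, monotone_liftX hhm, kahnPair_liftX hw' hK⟩
  | and_left _ hw' hY hv hvm ih =>
      obtain ⟨hw, hX, hg, hh, hgm, hhm, hK⟩ := ih
      exact ⟨isProbWeight_prodW hw hw', isHarris_prodW hw hw' hX hY, (isIndicator_liftX hg).mul (isIndicator_liftY hv),
        isIndicator_liftX hh, (monotone_liftX hgm).mul (monotone_liftY hvm) (fun z => hg.nonneg z.1) (fun z => hv.nonneg z.2),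
        monotone_liftX hhm, kahnPair_and_left hw hw' hX hY hg hh hgm hhm hvm hv.nonneg hK⟩
  | or_left _ hw' hY hv hvm ih =>
      obtain ⟨hw, hX, hg, hh, hgm, hhm, hK⟩ := ih
      exact ⟨isProbWeight_prodW hw hw', isHarris_prodW hw hw' hX hY, isIndicator_bor hg hv, isIndicator_liftX hh,
        monotone_bor hg hv hgm hvm, monotone_liftX hhm, kahnPair_or_left hw hw' hX hY hg hh hgm hhm hv hvm hK⟩
  | and_and _ hw' hY hv hvm ih =>
      obtain ⟨hw, hX, hg, hh, hgm, hhm, hK⟩ := ih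
      exact ⟨isProbWeight_prodW hw hw', isHarris_prodW hw hw' hX hY, (isIndicator_liftX hg).mul (isIndicator_liftY hv),
        (isIndicator_liftX hh).mul (isIndicator_liftY hv),
        (monotone_liftX hgm).mul (monotone_liftY hvm) (fun z => hg.nonneg z.1) (fun z => hv.nonneg z.2),
        (monotone_liftX hhm).mul (monotone_liftY hvm) (fun z => hh.nonneg z.1) (fun z => hv.nonneg z.2),
        kahnPair_and_and hw hw' hX hY hg hh hgm hhm hv hvm hK⟩
  | or_or _ hw' hY hv hvm ih =>
      obtain ⟨hw, hX, hg, hh, hgm, hhm, hK⟩ := ih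
      exact ⟨isProbWeight_prodW hw hw', isHarris_prodW hw hw' hX hY, isIndicator_bor hg hv, isIndicator_bor hh hv,
        monotone_bor hg hv hgm hvm, monotone_bor hh hv hhm hvm, kahnPair_or_or hw hw' hY hg hh hv hvm hK⟩
  | and_or _ hw' hY hv hvm ih =>
      obtain ⟨hw, hX, hg, hh, hgm, hhm, hK⟩ := ih
      exact ⟨isProbWeight_prodW hw hw', isHarris_prodW hw hw' hX hY, (isIndicator_liftX hg).mul (isIndicator_liftY hv),
        isIndicator_bor hh hv, (monotone_liftX hgm).mul (monotone_liftY hvm) (fun z => hg.nonneg z.1) (fun z => hv.nonneg z.2),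
        monotone_bor hh hv hhm hvm, kahnPair_and_or hw hw' hX hY hg hh hgm hv hvm⟩

/-- **Kahn's inequality for jointly module-peelable pairs**: if `(g,h)` is peelable on `(X,w)` then
`E₃(f,g,h) = 2E(fgh) − E(fg)E h − E(fh)E g − E(gh)E f + E f·E g·E h ≥ 0` for every monotone `f ≥ 0`
(Kahn's Conjecture 5 [Kahn 2022, Conj. 5] / Sahi's `C₃` [Sahi 2008, Conj. 5] for this class of triples). [this work] -/
theorem Peelable.kahnPair {X : Type u} [Fintype X] [Preorder X] {w g h : X → ℝ} (hP : Peelable X w g h) :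
    KahnPair w g h :=
  hP.invariant.2.2.2.2.2.2

/-- The events form of `Peelable.kahnPair`: for a peelable pair `(g,h)` and EVERY monotone `f ≥ 0` (e.g. the indicator of any
increasing event `A`), `0 ≤ E₃(f,g,h)`. [this work] -/
theorem Peelable.kahnK_nonneg {X : Type u} [Fintype X] [Preorder X] {w g h : X → ℝ} (hP : Peelable X w g h)
    {f : X → ℝ} (hf : Monotone f) (hf0 : ∀ x, 0 ≤ f x) : 0 ≤ kahnK w f g h :=
  hP.kahnPair f hf hf0

/-- Example of a derivation: on the product of three Harris probability spaces `X₁ × X₂ × X₃` (bracketed `(X₁ × X₂) × X₃`)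
with monotone indicators `u, v, t` of `U ⊆ X₁`, `V ⊆ X₂`, `T ⊆ X₃`, the pair `((U ∧ V) ∨ T, (U ∨ V) ∧ ... )` — here concretely
`(B,C) = ((U ∧ V) ∨ T, U ∨ T)`: peel `T` (joint top disjunct), then `V` (top conjunct of `B` only), then the nested base
`(U,U)`.  Hence `E₃(f, 1_B, 1_C) ≥ 0` for every monotone `f ≥ 0` on `X₁ × X₂ × X₃`. [this work] -/
theorem peelable_example {X₁ X₂ X₃ : Type u} [Fintype X₁] [Preorder X₁] [Fintype X₂] [Preorder X₂] [Fintype X₃]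
    [Preorder X₃] {w₁ u : X₁ → ℝ} {w₂ v : X₂ → ℝ} {w₃ t : X₃ → ℝ} (hw₁ : IsProbWeight w₁) (hX₁ : IsHarris w₁)
    (hw₂ : IsProbWeight w₂) (hX₂ : IsHarris w₂) (hw₃ : IsProbWeight w₃) (hX₃ : IsHarris w₃) (hu : IsIndicator u)
    (hum : Monotone u) (hv : IsIndicator v) (hvm : Monotone v) (ht : IsIndicator t) (htm : Monotone t) :
    Peelable ((X₁ × X₂) × X₃) (prodW (prodW w₁ w₂) w₃) (bor (liftX u * liftY v) t) (bor (liftX u) t) :=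
  .or_or (.and_left (.of_le hw₁ hX₁ hu hu hum hum fun _ => le_rfl) hw₂ hX₂ hv hvm) hw₃ hX₃ ht htm

end Summit.CriticalPhenomena.PercolationContinuityZ3.Theorems.SahiKahnModule
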